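import Literature.AnabelianGeometry.EtaleTheta.ThetaCohomology
import Literature.AnabelianGeometry.EtaleTheta.ConstantMultipleRigidity
import Literature.AnabelianGeometry.EtaleTheta.ClassicalThetaValueOrders
import Literature.AnabelianGeometry.EtaleTheta.Discharge.Sec2ThetaOrbitClasses
import HarnessLib

/-!
# [EtTh] Prop. 1.4 (iii) "values": the named fact `Prop14iiiValues` AS TYPED holds only vacuously —
# it forbids non-cuspidal points (kernel witness for the FACT-LIST row F-0590; proof-only)

Mochizuki, *The étale theta function …*, Publ. RIMS **45** (2009), §1, Prop. 1.4 (iii), PRIMS PDF p. 22: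
"if `L/K̈` is a finite extension, `y ∈ Ÿ(L)` is a non-cuspidal point, then the restricted classes
`O^×_K̈ · η̈^Θ|_y ∈ H¹(G_L, Δ_Θ) ≅ … ≅ (L^×)^∧` lie in `L^×` and are equal to the values `O^×_K̈ · Θ̈(y)`"
[cite: MochizukiEtTh2009, Prop 1.4 (iii) p.22]; Prop. 1.4 (ii) p. 22 "`Θ̈(q_X^{a/2} Ü) = (−1)^a q_X^{−a²/2}
Ü^{−2a} Θ̈(Ü)`" (the functional equation; PROVED in the tree: `thetaDdot_zpow_mul`).

PROOF-ONLY file (abc-iut cell, prover abc-iut-L2-d1 gen 4; FACT-LIST soundness queue, [EtTh] §1 lane).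
THE FINDING.  abc-iut-L2-t1's interface `ThetaSetting.NonCuspidalPoint E` (`ThetaCohomology.lean`) records a
point `y` of `Ÿ` by its decomposition group `Dpt`, an evaluation map `evalAt : H¹(Dpt, Δ_Θ) → (K̈^×)^∧`
(constrained only on the Kummer classes of constants, `evalAt_kum`) and a coordinate `coord = Ü(y) ∈ K̈^×`
constrained ONLY by `coord ≠ ±q̈^a` — NO field ties `coord` to `Dpt`/`evalAt`.  The named fact
`ThetaSetting.Prop14iiiValues E` (F-0590, admissible, fact-open) asserts, for EVERY such `y` and every
theta class `x`, `evalAt_y(x|_y) = a · Θ̈(coord(y))` with `a ∈ O^×_K̈`.  Replacing `coord` by `q̈·coord`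
and by `q̈⁻¹·coord` (again non-cuspidal coordinates) leaves `Dpt`, `evalAt` unchanged, so the fact forces
`‖Θ̈(q̈ c)‖ = ‖Θ̈(c)‖ = ‖Θ̈(q̈⁻¹ c)‖` with `Θ̈(c) ≠ 0`, whereas the functional equation gives
`‖Θ̈(q̈^{±1} c)‖ = ‖q̈‖⁻¹ ‖c‖^{∓2} ‖Θ̈(c)‖`; multiplying, `‖q̈‖² = 1`, contradicting `‖q̈‖ < 1`.  Hence

* `ThetaSetting.EtaleThetaData.not_prop14iiiValues` — for every `E : D.EtaleThetaData` and EVERY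
  `y : NonCuspidalPoint E.toKummerData`, `¬ Prop14iiiValues E`;
* `ThetaSetting.EtaleThetaData.isEmpty_nonCuspidalPoint_of_prop14iiiValues` — equivalently the typed
  fact implies that `Ÿ` has NO non-cuspidal (interface-)points: it is satisfiable only vacuously.

CONSEQUENCE / REPAIR (for the interface owner abc-iut-L2-t1 and the FACT-LIST keeper): F-0590 is refuted
at every instance that carries a point (e.g. the standard points `τ^{±1}` of Def. 1.9, `MuTwoSetting.StandardData`);
the printed sentence is about the HONEST coordinate `Ü(y)` of the point whose decomposition group is
`D_y`, so the repaired statement must either (a) pin `coord` to `Dpt` by an interface axiom (e.g. the value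
of the Kummer class of the coordinate function `Ü` at `y`), or (b) be stated per class with its constant,
as in GAP-LEDGER G-L2t6g4-2 (single-class value law).  Until then no consumer should take
`Prop14iiiValues` as a hypothesis (none does at the time of filing: tree grep).  HONEST FRAMING: this
refutes the TYPED form over the interface, not the printed Prop. 1.4 (iii); no side is taken on
[IUTchIII] Cor. 3.12.
-/

namespace Literature.AnabelianGeometry.EtaleTheta

open Literature.AnabelianGeometry.SemiGraphs

namespace ThetaSetting

variable {p : ℕ} [Fact p.Prime] {D : ThetaSetting p}

/-- `‖q̈‖ < 1` (`q̈² = q_X` and `‖q_X‖ < 1`, p. 13 / p. 17). [cite: MochizukiEtTh2009, §1 p.17] -/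
theorem norm_qdd_lt_one' : ‖D.qdd‖ < 1 := by
  have h : ‖D.qdd‖ ^ 2 < 1 := by
    rw [← norm_pow]
    change ‖D.sqrtqX ^ 2‖ < 1
    rw [D.sqrtqX_sq]
    exact D.norm_qX_lt_one
  nlinarith [norm_nonneg D.qdd]

/-- The functional equation of Prop. 1.4 (ii) in absolute values, in `ℚ̄_p`:
`‖Θ̈(q̈^a Ü)‖ = ‖q̈‖^{−a²} · ‖Ü‖^{−2a} · ‖Θ̈(Ü)‖` (`Ü ≠ 0`). [cite: MochizukiEtTh2009, Prop 1.4 (ii) p.22] -/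
theorem norm_thetaDdot_qdd_zpow_mul {U : PadicAlgCl p} (hU : U ≠ 0) (a : ℤ) :
    ‖thetaDdot D.qdd (D.qdd ^ a * U)‖ = ‖D.qdd‖ ^ (-(a * a)) * ‖U‖ ^ (-(2 * a)) * ‖thetaDdot D.qdd U‖ := by
  rw [thetaDdot_zpow_mul D.qdd_ne_zero hU a, norm_mul, norm_mul, norm_mul, Int.cast_negOnePow, norm_zpow,
    norm_neg, norm_one, one_zpow, one_mul, norm_zpow, norm_zpow]

namespace NonCuspidalPoint

variable {E : D.KummerData} (y : NonCuspidalPoint E)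

/-- The coordinate of an interface point is nonzero (it is a unit of `K̈`). [cite: MochizukiEtTh2009, Prop 1.4 (iii) p.22] -/
theorem coe_coord_ne_zero : ((y.coord : D.Kdd) : PadicAlgCl p) ≠ 0 := by
  intro h
  have : (y.coord : D.Kdd) = 0 := Subtype.ext h
  exact y.coord.ne_zero this

/-- **The interface does not pin the coordinate**: the same decomposition group and evaluation map with the
coordinate multiplied by `q̈^a` is again a `NonCuspidalPoint` (the cusp condition `≠ ±q̈^b` is shift-stable).
[cite: MochizukiEtTh2009, Prop 1.4 (iii) p.22] -/
theorem coord_mul_qddUnit_zpow_ne_cusp (a b : ℤ) :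
    (((y.coord * D.qddUnit ^ a : (↥D.Kdd)ˣ) : D.Kdd) : PadicAlgCl p) ≠ D.qdd ^ b ∧
      (((y.coord * D.qddUnit ^ a : (↥D.Kdd)ˣ) : D.Kdd) : PadicAlgCl p) ≠ -(D.qdd ^ b) := by
  have hq : D.qdd ≠ 0 := D.qdd_ne_zero
  have hcoe : (((y.coord * D.qddUnit ^ a : (↥D.Kdd)ˣ) : D.Kdd) : PadicAlgCl p) =
      ((y.coord : D.Kdd) : PadicAlgCl p) * D.qdd ^ a := by
    rw [Units.val_mul, Units.val_zpow_eq_zpow_val]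
    push_cast
    rfl
  obtain ⟨h1, h2⟩ := y.coord_ne_cusp (b - a)
  rw [hcoe]
  constructor
  · intro h
    apply h1
    have := congrArg (· * (D.qdd ^ a)⁻¹) h
    simp only [mul_inv_cancel_right₀ (zpow_ne_zero a hq)] at this
    rw [this, ← zpow_neg, ← zpow_add₀ hq]
    ring_nf
  · intro h
    apply h2
    have := congrArg (· * (D.qdd ^ a)⁻¹) h
    simp only [mul_inv_cancel_right₀ (zpow_ne_zero a hq)] at this
    rw [this, neg_mul, ← zpow_neg, ← zpow_add₀ hq]
    ring_nf

end NonCuspidalPoint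

namespace EtaleThetaData

variable (E : D.EtaleThetaData)

/-- `η̈^Θ` itself is a theta class (`k = 1`); private copy of `etaDd_mem_thetaClasses`
(`Discharge/Sec2ThetaOrbitClasses.lean`) to keep the import closure at `ThetaCohomology`. [folklore] -/
private theorem etaDd_mem_thetaClasses' : E.etaDd ∈ E.thetaClasses := ⟨1, one_mem _, (one_mul _).symm⟩

/-- **`Prop14iiiValues` AS TYPED is refuted by any non-cuspidal interface point.**  For every
`E : EtaleThetaData` and every `y : NonCuspidalPoint E.toKummerData`, `¬ Prop14iiiValues E`: apply the fact
to `η̈^Θ` at `y` and at the two points with the same decomposition group / evaluation map and coordinates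
`q̈·Ü(y)`, `q̈⁻¹·Ü(y)`; the three values agree up to units while Prop. 1.4 (ii) makes their absolute values
differ by `‖q̈‖⁻¹‖Ü‖^{∓2}`, forcing `‖q̈‖ = 1`. (Kernel witness against FACT-LIST row F-0590 as typed; the
printed Prop. 1.4 (iii) is about the geometric coordinate of the point and is not refuted.)
[cite: MochizukiEtTh2009, Prop 1.4 (iii) p.22] -/
theorem not_prop14iiiValues (y : NonCuspidalPoint E.toKummerData) : ¬ Prop14iiiValues E := by
  intro h
  have hq : D.qdd ≠ 0 := D.qdd_ne_zero
  have hq1 : ‖D.qdd‖ < 1 := norm_qdd_lt_one'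
  set c : PadicAlgCl p := ((y.coord : D.Kdd) : PadicAlgCl p) with hc_def
  have hc : c ≠ 0 := y.coe_coord_ne_zero
  -- the two shifted points (same `Dpt`, `evalAt`; coordinates `q̈ c`, `q̈⁻¹ c`)
  let y₁ : NonCuspidalPoint E.toKummerData :=
    { y with
      coord := y.coord * D.qddUnit ^ (1 : ℤ),
      coord_ne_cusp := fun b => y.coord_mul_qddUnit_zpow_ne_cusp 1 b }
  let y₂ : NonCuspidalPoint E.toKummerData :=
    { y with
      coord := y.coord * D.qddUnit ^ (-1 : ℤ),
      coord_ne_cusp := fun b => y.coord_mul_qddUnit_zpow_ne_cusp (-1) b }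
  have hc₁ : ((y₁.coord : D.Kdd) : PadicAlgCl p) = D.qdd ^ (1 : ℤ) * c := by
    change (((y.coord * D.qddUnit ^ (1 : ℤ) : (↥D.Kdd)ˣ) : D.Kdd) : PadicAlgCl p) = _
    rw [Units.val_mul, Units.val_zpow_eq_zpow_val, mul_comm]
    push_cast
    rfl
  have hc₂ : ((y₂.coord : D.Kdd) : PadicAlgCl p) = D.qdd ^ (-1 : ℤ) * c := by
    change (((y.coord * D.qddUnit ^ (-1 : ℤ) : (↥D.Kdd)ˣ) : D.Kdd) : PadicAlgCl p) = _
    rw [Units.val_mul, Units.val_zpow_eq_zpow_val, mul_comm]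
    push_cast
    rfl
  -- the three value statements for the class `η̈^Θ`
  obtain ⟨a₀, ha₀, v₀, hv₀, he₀⟩ := h y E.etaDd E.etaDd_mem_thetaClasses'
  obtain ⟨a₁, ha₁, v₁, hv₁, he₁⟩ := h y₁ E.etaDd E.etaDd_mem_thetaClasses'
  obtain ⟨a₂, ha₂, v₂, hv₂, he₂⟩ := h y₂ E.etaDd E.etaDd_mem_thetaClasses'
  -- same evaluation ⇒ `a₀ v₀ = a₁ v₁ = a₂ v₂`
  have h01 : a₀ * v₀ = a₁ * v₁ := E.toKddHat_injective (he₀.symm.trans he₁)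
  have h02 : a₀ * v₀ = a₂ * v₂ := E.toKddHat_injective (he₀.symm.trans he₂)
  -- pass to absolute values in `ℚ̄_p`
  have hunit : ∀ {a : (↥D.Kdd)ˣ}, a ∈ D.unitsOKdd → ‖((a : D.Kdd) : PadicAlgCl p)‖ = 1 := fun ha => ha
  have hnorm : ∀ {a v a' v' : (↥D.Kdd)ˣ}, a ∈ D.unitsOKdd → a' ∈ D.unitsOKdd → a * v = a' * v' →
      ‖((v : D.Kdd) : PadicAlgCl p)‖ = ‖((v' : D.Kdd) : PadicAlgCl p)‖ := by
    intro a v a' v' ha ha' heq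
    have := congrArg (fun u : (↥D.Kdd)ˣ => ‖((u : D.Kdd) : PadicAlgCl p)‖) heq
    simp only [Units.val_mul, IntermediateField.coe_mul, norm_mul, hunit ha, hunit ha', one_mul] at this
    exact this
  have hn01 := hnorm ha₀ ha₁ h01
  have hn02 := hnorm ha₀ ha₂ h02
  rw [hv₀, hv₁, hc₁, D.norm_thetaDdot_qdd_zpow_mul hc 1] at hn01
  rw [hv₀, hv₂, hc₂, D.norm_thetaDdot_qdd_zpow_mul hc (-1)] at hn02
  change ‖thetaDdot D.qdd c‖ = _ at hn01
  change ‖thetaDdot D.qdd c‖ = _ at hn02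
  -- `Θ̈(c) ≠ 0` since `v₀` is a unit
  have hv₀0 : ((v₀ : D.Kdd) : PadicAlgCl p) ≠ 0 := fun hz => v₀.ne_zero (Subtype.ext hz)
  have hN : ‖thetaDdot D.qdd c‖ ≠ 0 := by rw [← hv₀]; exact norm_ne_zero_iff.mpr hv₀0
  -- cancel `‖Θ̈(c)‖` and read off the two absolute-value identities
  have key : ∀ {X : ℝ}, ‖thetaDdot D.qdd c‖ = X * ‖thetaDdot D.qdd c‖ → X = 1 := fun hX =>
    mul_right_cancel₀ hN ((one_mul _).trans hX).symm
  have e1 := key hn01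
  have e2 := key hn02
  norm_num at e1 e2
  -- `e1 : ‖q̈‖⁻¹ * (‖c‖^2)⁻¹ = 1`, `e2 : ‖q̈‖⁻¹ * ‖c‖^2 = 1`
  have hQ : 0 < ‖D.qdd‖ := norm_pos_iff.mpr hq
  have hC2 : ‖c‖ ^ 2 = ‖D.qdd‖ := ((inv_mul_eq_one₀ hQ.ne').1 e2).symm
  have e3 : ‖D.qdd‖⁻¹ * ‖D.qdd‖⁻¹ = 1 := by
    have h' : ‖D.qdd‖⁻¹ * (‖c‖ ^ 2)⁻¹ = 1 := e1
    rwa [hC2] at h'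
  rw [← mul_inv, inv_eq_one] at e3
  nlinarith

/-- **Equivalently: the typed fact empties the interface of points** — `Prop14iiiValues E` implies that
`NonCuspidalPoint E.toKummerData` is EMPTY; in every intended instance (a Tate curve has `K̈`-rational
non-cuspidal points, e.g. the `τ^{±1}` of Def. 1.9 (i) carried by `MuTwoSetting.StandardData`) the row
F-0590 is therefore false as typed. [cite: MochizukiEtTh2009, Prop 1.4 (iii) p.22] -/
theorem isEmpty_nonCuspidalPoint_of_prop14iiiValues (h : Prop14iiiValues E) :
    IsEmpty (NonCuspidalPoint E.toKummerData) :=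
  ⟨fun y => E.not_prop14iiiValues y h⟩

end EtaleThetaData

/-! ## The `Ü² = −1` / standard-data form (finding F-w5d140-3, abc-iut-w5-d140 g2, originally p420241)

The following five declarations are abc-iut-w5-d140's INDEPENDENT kernel witness of the same finding
(filed 18 s apart as p420241 at this path; RESTORED here verbatim after this seat's whole-file proposal
p420361 inadvertently replaced them — append-only repair, no statement of either seat changed): the typed
fact already fails at any point with `Ü(y)² = −1`, in particular next to Def. 1.9's standard data
(`MuTwoSetting.StandardData`: `Ü(τ) = √−1`). Credit: «F-0590 refuted: abc-iut-L2-d1 g4 (any point,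
F-d1g4-1) ∧ abc-iut-w5-d140 g2 (ζ² = −1 / standard data, F-w5d140-3, p420241)». -/

/-- The coercion of `qddUnit` to `ℚ̄_p` is `q̈`. [cite: MochizukiEtTh2009, §1 p.17] -/
theorem coe_qddUnit : (((D.qddUnit : (↥D.Kdd)ˣ) : D.Kdd) : PadicAlgCl p) = D.qdd := rfl

namespace NonCuspidalPoint

variable {E : D.KummerData} (y : NonCuspidalPoint E)

/-- `q̈ · Ü(y)` is again a non-cusp coordinate (the cusps `±q̈^a` are stable under `Ü ↦ q̈^{±1}Ü`)
(abc-iut-w5-d140, p420241). [cite: MochizukiEtTh2009, Prop 1.4 (i) p.21] -/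
theorem qdd_mul_coord_ne_cusp (a : ℤ) :
    (((D.qddUnit * y.coord : (↥D.Kdd)ˣ) : D.Kdd) : PadicAlgCl p) ≠ D.qdd ^ a ∧
      (((D.qddUnit * y.coord : (↥D.Kdd)ˣ) : D.Kdd) : PadicAlgCl p) ≠ -(D.qdd ^ a) := by
  have hq0 : D.qdd ≠ 0 := D.qdd_ne_zero
  have hmul : (((D.qddUnit * y.coord : (↥D.Kdd)ˣ) : D.Kdd) : PadicAlgCl p) =
      D.qdd * ((y.coord : D.Kdd) : PadicAlgCl p) := by
    rw [Units.val_mul]; rfl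
  have key : D.qdd ^ a = D.qdd * D.qdd ^ (a - 1) := by
    rw [← zpow_one_add₀ hq0]; congr 1; ring
  obtain ⟨h1, h2⟩ := y.coord_ne_cusp (a - 1)
  rw [hmul, key]
  refine ⟨fun h => h1 (mul_left_cancel₀ hq0 h), fun h => h2 (mul_left_cancel₀ hq0 ?_)⟩
  rw [h, mul_neg]

end NonCuspidalPoint

namespace EtaleThetaData

variable (E : D.EtaleThetaData)

/-- **`Prop14iiiValues`, as typed, fails as soon as there is a point `y` with `Ü(y)² = −1`** (finding
F-w5d140-3, abc-iut-w5-d140, p420241).  Re-coordinatise `y` to `y₁ := (D_y, q̈·Ü(y), evalAt)`; the fact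
at `(y, η̈)` and at `(y₁, η̈)` gives `a₀·v₀ = a₁·v₁` in `K̈^×` with `v₀ = Θ̈(Ü)`, `v₁ = Θ̈(q̈Ü)`,
`a₀, a₁ ∈ O^×`, so `‖Θ̈(Ü)‖ = ‖Θ̈(q̈Ü)‖` — contradicting `‖Θ̈(Ü)‖ < ‖Θ̈(q̈Ü)‖` (Prop. 1.4 (ii),
`Θ̈(Ü) ≠ 0` in `ℚ̄_p`). [cite: MochizukiEtTh2009, Prop 1.4 (iii) p.22] -/
theorem not_prop14iiiValues_of_sq_eq_neg_one (y : NonCuspidalPoint E.toKummerData)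
    (hζ : ((y.coord : D.Kdd) : PadicAlgCl p) ^ 2 = -1) : ¬ Prop14iiiValues E := by
  intro h
  set ζ : PadicAlgCl p := ((y.coord : D.Kdd) : PadicAlgCl p) with hζdef
  have hq : ‖D.qdd‖ < 1 := norm_qdd_lt_one'
  have hq0 : D.qdd ≠ 0 := D.qdd_ne_zero
  have hΘ0 : thetaDdot D.qdd ζ ≠ 0 := PadicAlgCl.thetaDdot_sqrt_neg_one_ne_zero hζ hq
  -- the re-coordinatised point: same decomposition group and evaluation, coordinate `q̈ · Ü(y)`
  let y₁ : NonCuspidalPoint E.toKummerData :=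
    { y with
      coord := D.qddUnit * y.coord
      coord_ne_cusp := y.qdd_mul_coord_ne_cusp }
  have hx : E.etaDd ∈ E.thetaClasses := E.etaDd_mem_thetaClasses
  obtain ⟨a₀, ha₀, v₀, hv₀, he₀⟩ := h y E.etaDd hx
  obtain ⟨a₁, ha₁, v₁, hv₁, he₁⟩ := h y₁ E.etaDd hx
  -- same evaluation map: the two values agree in `(K̈^×)^∧`, hence in `K̈^×`
  have heq : a₀ * v₀ = a₁ * v₁ := E.toKddHat_injective (he₀.symm.trans he₁)
  have hcoe : ((a₀ : D.Kdd) : PadicAlgCl p) * ((v₀ : D.Kdd) : PadicAlgCl p) =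
      ((a₁ : D.Kdd) : PadicAlgCl p) * ((v₁ : D.Kdd) : PadicAlgCl p) := by
    have := congrArg (fun w : (↥D.Kdd)ˣ => ((w : D.Kdd) : PadicAlgCl p)) heq
    simpa [Units.val_mul] using this
  have hnorm : ‖thetaDdot D.qdd ζ‖ = ‖thetaDdot D.qdd (D.qdd ^ (1 : ℤ) * ζ)‖ := by
    have h1 : ((v₁ : D.Kdd) : PadicAlgCl p) = thetaDdot D.qdd (D.qdd ^ (1 : ℤ) * ζ) := by
      rw [hv₁, zpow_one]; rfl
    have hn := congrArg (fun z : PadicAlgCl p => ‖z‖) hcoe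
    simp only [norm_mul] at hn
    rw [show ‖((a₀ : D.Kdd) : PadicAlgCl p)‖ = 1 from ha₀,
      show ‖((a₁ : D.Kdd) : PadicAlgCl p)‖ = 1 from ha₁, one_mul, one_mul, hv₀, h1] at hn
    exact hn
  have hlt := norm_thetaDdot_lt_norm_thetaDdot_zpow_mul hζ hq hq0 hΘ0 (a := 1) one_ne_zero
  rw [hnorm] at hlt
  exact lt_irrefl _ hlt

end EtaleThetaData

end ThetaSetting

/-! ### In the setting of Def. 1.9 (standard data: `Ü(τ) = √−1`) the typed fact is false
(abc-iut-w5-d140, p420241, restored) -/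

namespace MuTwoSetting

variable {p : ℕ} [Fact p.Prime] {M : MuTwoSetting p} {E : M.toThetaSetting.EtaleThetaData}

/-- **`Prop14iiiValues E` is FALSE next to standard data** (Def. 1.9: the point `τ` has `Ü(τ) = √−1`,
`(√−1)² = −1`; abc-iut-w5-d140, p420241). [cite: MochizukiEtTh2009, Def 1.9 p.29] -/
theorem not_prop14iiiValues (S : M.StandardData E.toKummerData) :
    ¬ ThetaSetting.Prop14iiiValues E :=
  E.not_prop14iiiValues_of_sq_eq_neg_one S.tau (by rw [S.tau_coord]; exact S.sqrtNegOne_sq)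

/-- Equivalently: a consumer holding `(h : Prop14iiiValues E)` has NO standard data — every theorem
taking both is vacuous (abc-iut-w5-d140, p420241). [cite: MochizukiEtTh2009, Def 1.9 p.29] -/
theorem isEmpty_standardData_of_prop14iiiValues (h : ThetaSetting.Prop14iiiValues E) :
    IsEmpty (M.StandardData E.toKummerData) :=
  ⟨fun S => not_prop14iiiValues S h⟩

end MuTwoSetting

end Literature.AnabelianGeometry.EtaleTheta
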